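import Summits.ValiantsHypothesis.ValiantsHypothesis.Theorems.TwoProducts.RankTwoJacobianAxial

/-!
# Rank-two Jacobian, P4a: CHARTS `dir σ l`, unique tops, ties, and Stage A (the upper envelope of lines)

`Expo`, `dir`, `wt_dir`, `TieIn`, `IsUTop`, `cross`, the chart identities, and ★ `exists_tie_between` / `card_utop_le` (between two distinct unique tops lies a tie; so the
number of chart-unique tops is controlled by the tie directions).

P4 «TowerKernel» port (val-lit-p3 g18, desk #461 (D)/#465 (C); critic of record val-idea-crit-8 g3 CONTENT GO 03:36:15Z, VERDICT #38 «K13 K1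
`rankTwoCompositionLaw` KERNEL ✓») of `section TowerKernel` (l.645–1593) of val-idea-35 g9's crux workfile `Cruxes/TwoProducts/RankTwoJacobian_val_idea_35_g9.lean`
@a021fde990ed (sha16 2c954d16062836ab, 1595 l., 0 sorry) — bodies VERBATIM, namespace `…Cruxes.TwoProducts.ValIdea35g9` → `…Theorems.TwoProducts.RankTwoJacobian`,
split at the Stage seams for the 400-line lint (TowerCharts = charts + Stage A; TowerExceptional = Stage C up to `Eset`; TowerSpecials = Stage C from `Spec`;
TowerInduction = Stages D + B; Tower = Stage E + K1), one-line docstrings added where the workfile had none; over ✓ P1–P3 `…RankTwoJacobian{,Ostrowski,Axial}`.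
HONEST LABEL: K13 K1 = the decided sub-class «affine table rank ≤ 2» of the SIDE ladder «table-rank-ladder» of crux `stmt-ValiantsHypothesis-5906` (`TwoProducts`);
0 distance on `ResidualLawV25`; nothing here closes 5906 / `PlanarCellBound`; VP ≠ VNP is NOT proved.  `--supports stmt-ValiantsHypothesis-5906 --as helper`.
Credit: val-idea-35 g9 (everything).  No instances, no notation, no named facts. [folklore]
-/

noncomputable section
set_option linter.dupNamespace false

namespace Summit.ValiantsHypothesis.ValiantsHypothesis.Theorems.TwoProducts.RankTwoJacobian

open scoped BigOperators Pointwise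
open MvPolynomial

section TowerKernel
open scoped Classical



/-- Exponents of bivariate monomials (local abbreviation). [folklore] -/
abbrev Expo := Fin 2 →₀ ℕ

/-- chart direction `(l, σ)`, `σ = ±1` -/
def dir (σ l : ℝ) : Fin 2 → ℝ := ![l, σ]

/-- Weight in the chart direction `dir σ l = (l, σ)`. [folklore] -/
theorem wt_dir (σ l : ℝ) (q : Expo) :
    wt (dir σ l) q = l * ((q 0 : ℕ) : ℝ) + σ * ((q 1 : ℕ) : ℝ) := by
  simp [wt, dir]

/-- a tie (≥ 2 top points) of the finite exponent set `S` in direction `ν`;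
`IsEdgeDir ν F` is literally `TieIn ν F.support`. -/
def TieIn (ν : Fin 2 → ℝ) (S : Finset Expo) : Prop :=
  ∃ p ∈ S, ∃ q ∈ S, p ≠ q ∧ (∀ r ∈ S, wt ν r ≤ wt ν p) ∧ wt ν q = wt ν p

/-- `p` is the unique top point of `S` in direction `ν` -/
def IsUTop (ν : Fin 2 → ℝ) (S : Finset Expo) (p : Expo) : Prop :=
  p ∈ S ∧ ∀ r ∈ S, r ≠ p → wt ν r < wt ν p

/-- A unique top is unique. [folklore] -/
theorem utop_unique {ν : Fin 2 → ℝ} {S : Finset Expo} {p p' : Expo} (hp : IsUTop ν S p)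
    (hp' : IsUTop ν S p') : p = p' := by
  by_contra h
  have h1 := hp.2 p' hp'.1 (Ne.symm h)
  have h2 := hp'.2 p hp.1 h
  linarith

/-- A unique top excludes a tie. [folklore] -/
theorem not_tie_of_utop {ν : Fin 2 → ℝ} {S : Finset Expo} {p : Expo} (hp : IsUTop ν S p) :
    ¬ TieIn ν S := by
  rintro ⟨a, ha, b, hb, hab, hamax, hba⟩
  -- a and b are both tops; p is the unique top, so a = p and b = p
  have ha' : a = p := by
    by_contra h; have := hp.2 a ha h; have := hamax p hp.1; linarith
  have hb' : b = p := by
    by_contra h; have := hp.2 b hb h; have := hamax p hp.1; linarith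
  exact hab (ha'.trans hb'.symm)

/-- Exponents with equal coordinates are equal. [folklore] -/
theorem expo_eq_of_coords {a b : Expo} (h0 : a 0 = b 0) (h1 : a 1 = b 1) : a = b := by
  ext i; fin_cases i <;> assumption

/-- `σ = ±1` is nonzero. [folklore] -/
theorem sigma_ne_zero {σ : ℝ} (hσ : σ = 1 ∨ σ = -1) : σ ≠ 0 := by
  rcases hσ with h | h <;> simp [h]

/-- in a chart, equal weights and equal first coordinates force equality -/
theorem eq_of_wt_eq {σ : ℝ} (hσ : σ = 1 ∨ σ = -1) {l : ℝ} {a b : Expo} (h0 : a 0 = b 0)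
    (hw : wt (dir σ l) a = wt (dir σ l) b) : a = b := by
  apply expo_eq_of_coords h0
  rw [wt_dir, wt_dir, h0] at hw
  have h2 : σ * ((a 1 : ℕ) : ℝ) = σ * ((b 1 : ℕ) : ℝ) := by linarith
  have := mul_left_cancel₀ (sigma_ne_zero hσ) h2
  exact_mod_cast this

/-- the crossing value of the pair `(a,b)` (with `a 0 ≠ b 0`) in chart `σ` -/
def cross (σ : ℝ) (a b : Expo) : ℝ :=
  σ * (((b 1 : ℕ) : ℝ) - ((a 1 : ℕ) : ℝ)) / (((a 0 : ℕ) : ℝ) - ((b 0 : ℕ) : ℝ))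

/-- Difference of chart weights of two exponents. [folklore] -/
theorem wt_sub_eq (σ l : ℝ) (a b : Expo) :
    wt (dir σ l) a - wt (dir σ l) b =
      l * (((a 0 : ℕ) : ℝ) - ((b 0 : ℕ) : ℝ)) + σ * (((a 1 : ℕ) : ℝ) - ((b 1 : ℕ) : ℝ)) := by
  rw [wt_dir, wt_dir]; ring

/-- Distinct first coordinates give a nonzero real difference. [folklore] -/
theorem sub_ne_zero_of_ne0 {a b : Expo} (h0 : a 0 ≠ b 0) :
    (((a 0 : ℕ) : ℝ) - ((b 0 : ℕ) : ℝ)) ≠ 0 := by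
  intro h; apply h0; exact_mod_cast (sub_eq_zero.mp h)

/-- Equal weights at slope `l` determine `l` as the cross ratio. [folklore] -/
theorem wt_eq_imp_cross {σ l : ℝ} {a b : Expo} (h0 : a 0 ≠ b 0)
    (hw : wt (dir σ l) a = wt (dir σ l) b) : l = cross σ a b := by
  have hd := sub_ne_zero_of_ne0 h0
  unfold cross
  rw [eq_div_iff hd]
  have := wt_sub_eq σ l a b
  rw [hw, sub_self] at this
  linarith

/-- `g(x) := wt_x a − wt_x b = (x − cross) · (a0 − b0)` -/
theorem wt_sub_eq_cross {σ : ℝ} (x : ℝ) {a b : Expo} (h0 : a 0 ≠ b 0) :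
    wt (dir σ x) a - wt (dir σ x) b = (x - cross σ a b) * (((a 0 : ℕ) : ℝ) - ((b 0 : ℕ) : ℝ)) := by
  have hd := sub_ne_zero_of_ne0 h0
  rw [wt_sub_eq]; unfold cross
  field_simp
  ring

/-! ### Stage A: the upper envelope of lines — between two distinct unique tops lies a tie -/

/-- **Stage A.** Between two distinct unique tops (at `l < l'`) of the upper envelope of lines lies a tie. [val-idea-35 g9] -/
theorem exists_tie_between {σ : ℝ} (_hσ : σ = 1 ∨ σ = -1) (S : Finset Expo) {p p' : Expo} {l l' : ℝ}
    (hll : l < l') (hp : IsUTop (dir σ l) S p) (hp' : IsUTop (dir σ l') S p') (hne : p ≠ p') :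
    ∃ μ, l < μ ∧ μ < l' ∧ TieIn (dir σ μ) S := by
  have gp'l : 0 < wt (dir σ l) p - wt (dir σ l) p' := sub_pos.mpr (hp.2 p' hp'.1 (Ne.symm hne))
  have gp'l' : wt (dir σ l') p - wt (dir σ l') p' < 0 := sub_neg.mpr (hp'.2 p hp.1 hne)
  -- slope of g_{p'} is (p0 − p'0),必 negative
  have hslope : p 0 < p' 0 := by
    by_contra h; push Not at h
    have h' : ((p' 0 : ℕ) : ℝ) ≤ ((p 0 : ℕ) : ℝ) := by exact_mod_cast h
    rw [wt_sub_eq] at gp'l gp'l'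
    nlinarith
  set Q := S.filter (fun q => p 0 < q 0) with hQ
  have hp'Q : p' ∈ Q := Finset.mem_filter.mpr ⟨hp'.1, hslope⟩
  set C := Q.image (cross σ p) with hC
  have hCne : C.Nonempty := ⟨_, Finset.mem_image_of_mem _ hp'Q⟩
  -- key facts for q with q0 > p0
  have key : ∀ q ∈ Q, l < cross σ p q ∧
      ∀ x, x ≤ cross σ p q → 0 ≤ wt (dir σ x) p - wt (dir σ x) q := by
    intro q hq
    obtain ⟨hqS, hq0⟩ := Finset.mem_filter.mp hq
    have hne0 : p 0 ≠ q 0 := Nat.ne_of_lt hq0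
    have hA : (((p 0 : ℕ) : ℝ) - ((q 0 : ℕ) : ℝ)) < 0 := by
      have : ((p 0 : ℕ) : ℝ) < ((q 0 : ℕ) : ℝ) := by exact_mod_cast hq0
      linarith
    have hqp : q ≠ p := by rintro rfl; exact lt_irrefl _ hq0
    have gl : 0 < wt (dir σ l) p - wt (dir σ l) q := sub_pos.mpr (hp.2 q hqS hqp)
    rw [wt_sub_eq_cross l hne0] at gl
    refine ⟨?_, ?_⟩
    · by_contra h; push Not at h
      have : (l - cross σ p q) * (((p 0 : ℕ) : ℝ) - ((q 0 : ℕ) : ℝ)) ≤ 0 :=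
        mul_nonpos_of_nonneg_of_nonpos (sub_nonneg.mpr h) hA.le
      linarith
    · intro x hx
      rw [wt_sub_eq_cross x hne0]
      exact mul_nonneg_of_nonpos_of_nonpos (sub_nonpos.mpr hx) hA.le
  set μ := C.min' hCne with hμ
  obtain ⟨qs, hqsQ, hqs⟩ := Finset.mem_image.mp (C.min'_mem hCne)
  have hqsμ : cross σ p qs = μ := by rw [hqs, hμ]
  have hqsS : qs ∈ S := (Finset.mem_filter.mp hqsQ).1
  have hqs0 : p 0 < qs 0 := (Finset.mem_filter.mp hqsQ).2
  refine ⟨μ, ?_, ?_, ?_⟩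
  · rw [← hqsμ]; exact (key qs hqsQ).1
  · -- μ ≤ cross p p' < l'
    have h1 : μ ≤ cross σ p p' := C.min'_le _ (Finset.mem_image_of_mem _ hp'Q)
    have hne0 : p 0 ≠ p' 0 := Nat.ne_of_lt hslope
    have h2 : cross σ p p' < l' := by
      rw [wt_sub_eq_cross l' hne0] at gp'l'
      by_contra h; push Not at h
      have hA : (((p 0 : ℕ) : ℝ) - ((p' 0 : ℕ) : ℝ)) < 0 := by
        have : ((p 0 : ℕ) : ℝ) < ((p' 0 : ℕ) : ℝ) := by exact_mod_cast hslope
        linarith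
      have : 0 ≤ (l' - cross σ p p') * (((p 0 : ℕ) : ℝ) - ((p' 0 : ℕ) : ℝ)) :=
        mul_nonneg_of_nonpos_of_nonpos (sub_nonpos.mpr h) hA.le
      linarith
    linarith
  · refine ⟨p, hp.1, qs, hqsS, ?_, ?_, ?_⟩
    · rintro rfl; exact lt_irrefl _ hqs0
    · intro r hr
      by_cases hr0 : p 0 < r 0
      · have hrQ : r ∈ Q := Finset.mem_filter.mpr ⟨hr, hr0⟩
        have hle : μ ≤ cross σ p r := C.min'_le _ (Finset.mem_image_of_mem _ hrQ)
        have := (key r hrQ).2 μ hle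
        linarith
      · push Not at hr0
        by_cases hrp : r = p
        · rw [hrp]
        · have gl : 0 < wt (dir σ l) p - wt (dir σ l) r := sub_pos.mpr (hp.2 r hr hrp)
          have hμl : l < μ := by rw [← hqsμ]; exact (key qs hqsQ).1
          have hA : 0 ≤ (((p 0 : ℕ) : ℝ) - ((r 0 : ℕ) : ℝ)) := by
            have : ((r 0 : ℕ) : ℝ) ≤ ((p 0 : ℕ) : ℝ) := by exact_mod_cast hr0
            linarith
          have e1 := wt_sub_eq σ l p r
          have e2 := wt_sub_eq σ μ p r
          nlinarith
    · have hne0 : p 0 ≠ qs 0 := Nat.ne_of_lt hqs0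
      have := wt_sub_eq_cross (σ := σ) μ hne0
      rw [hqsμ, sub_self, zero_mul] at this
      linarith

/-- counting unique tops in a chart: at most `#ties + 1` -/
theorem card_utop_le {σ : ℝ} (hσ : σ = 1 ∨ σ = -1) (S : Finset Expo) (E : Finset ℝ)
    (hE : ∀ μ, TieIn (dir σ μ) S → μ ∈ E) (T : Finset Expo)
    (hT : ∀ p ∈ T, ∃ l, IsUTop (dir σ l) S p) : T.card ≤ E.card + 1 := by
  choose! lam hlam using hT
  let g : Expo → WithTop ℝ := fun p => (E.filter (fun μ => lam p < μ)).min
  have hg_mem : ∀ p ∈ T, g p ∈ insert ⊤ (E.image (fun μ : ℝ => (μ : WithTop ℝ))) := by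
    intro p _
    rcases h : g p with _ | a
    · exact Finset.mem_insert_self _ _
    · apply Finset.mem_insert_of_mem
      have ha : a ∈ E.filter (fun μ => lam p < μ) := Finset.mem_of_min h
      exact Finset.mem_image_of_mem _ (Finset.mem_filter.mp ha).1
  have hg_gt : ∀ p, ((lam p : ℝ) : WithTop ℝ) < g p := by
    intro p
    rcases h : g p with _ | a
    · exact WithTop.coe_lt_top _
    · have ha : a ∈ E.filter (fun μ => lam p < μ) := Finset.mem_of_min h
      exact WithTop.coe_lt_coe.mpr (Finset.mem_filter.mp ha).2
  have hlt : ∀ p ∈ T, ∀ p' ∈ T, p ≠ p' → lam p < lam p' → g p < g p' := by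
    intro p hp p' hp' hne h
    obtain ⟨μ, h1, h2, htie⟩ := exists_tie_between hσ S h (hlam p hp) (hlam p' hp') hne
    have hgp : g p ≤ (μ : WithTop ℝ) := Finset.min_le (Finset.mem_filter.mpr ⟨hE μ htie, h1⟩)
    have : (μ : WithTop ℝ) < g p' :=
      lt_trans (WithTop.coe_lt_coe.mpr h2) (hg_gt p')
    exact lt_of_le_of_lt hgp this
  have hinj : Set.InjOn g T := by
    intro p hp p' hp' hgg
    by_contra hne
    rcases lt_trichotomy (lam p) (lam p') with h | h | h
    · exact absurd hgg (ne_of_lt (hlt p hp p' hp' hne h))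
    · have e1 := hlam p hp
      rw [h] at e1
      exact hne (utop_unique e1 (hlam p' hp'))
    · exact absurd hgg.symm (ne_of_lt (hlt p' hp' p hp (Ne.symm hne) h))
  calc T.card ≤ (insert ⊤ (E.image (fun μ : ℝ => (μ : WithTop ℝ)))).card :=
        Finset.card_le_card_of_injOn g (fun p hp => hg_mem p hp) hinj
    _ ≤ (E.image (fun μ : ℝ => (μ : WithTop ℝ))).card + 1 := Finset.card_insert_le _ _
    _ ≤ E.card + 1 := by
        have := Finset.card_image_le (s := E) (f := fun μ : ℝ => (μ : WithTop ℝ)); omega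


end TowerKernel

end Summit.ValiantsHypothesis.ValiantsHypothesis.Theorems.TwoProducts.RankTwoJacobian

end
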